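import Mathlib
import Summits.Ventures.PercRepro.TriangleCapResidueMin
import Summits.Ventures.PercRepro.TriangleCapNearRegular

/-!
# PercRepro — THE EXACT BOTTOM OF THE DEEP SUB-BAND FOR `t = m D + 1` AND `t = m D + (D − 1)`, `D ≤ m`, EVERY `ℓ`, ALL GRAPHS
(p3, gen 55; part 313)

For the residues `r = 1` and `r = D − 1` the closed-form residue minimum of part 312 equals the bipartite value:
`min(2 (D − 1), 2 + φ_D(2)) = 2 (D − 1)` (`φ_D(2) = 2 (D − 2)` for `D ≥ 3`, `0` for `D = 2`) and
`min(2 (D − 1), 2 + φ_D(2 D − 2)) = 2 (D − 1)` (`φ_D(2 D − 2) = φ_D(D − 2)`).  So the parity trick of part 301 gains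
nothing there, and the near-regular witness of part 307 is the bottom for EVERY graph of the band (bipartite or not):

**THEOREM** (`else_bottom_exact_residue_one`, `else_bottom_exact_residue_pred`; `2 ≤ D ≤ m`, `m + 1 ≤ ℓ`, `2 t ≤ s`):
on `ℓ + 1 + (s − t)` vertices every graph of the band with every off-degree `≤ D` has
`t (t − 1) + 2 (D − 1) ≤ 2 j + 2 t (D − 1)` for `t = m D + 1` and for `t = m D + (D − 1)`, and the near-regular witness
attains it — the bottom of the deep sub-band `u = t − D` is `C(t,2) − t (D − 1) + (D − 1)`, the g54 else formula,
for every `ℓ`.  (With part 296 at `r = 0` the else formula is the general bottom for `r ∈ {0, 1, D − 1}`; for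
`2 ≤ r ≤ D − 2` it is the bipartite bottom only — part 305.)  Axioms: standard.
-/

namespace PercRepro

namespace TriangleCap

namespace C047

open Finset

/-- `φ_D(2) = 2 (D − 2)` for `D ≥ 3`, and `φ_2(2) = 0`. -/
theorem phiD_two (D : ℕ) (hD : 2 ≤ D) : phiD D 2 = 2 * (D - 2) := by
  rcases Nat.lt_or_ge 2 D with h | h
  · rw [phiD_of_lt D 2 h]
  · have : D = 2 := by omega
    subst this
    rw [phiD_self]

/-- The residue minimum at `r = 1` is the bipartite value `2 (D − 1)`. -/
theorem residue_min_one (D : ℕ) (hD : 2 ≤ D) :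
    min (2 * (1 * (D - 1))) (2 * min 1 (D - 1) + phiD D 2) = 2 * (D - 1) := by
  rw [phiD_two D hD, min_eq_left (by omega : 1 ≤ D - 1)]
  have : 2 * (1 * (D - 1)) = 2 * (D - 1) := by ring
  rw [this]
  apply min_eq_left
  omega

/-- `φ_D(2 (D − 1)) = φ_D(D − 2) = 2 (D − 2)` for `D ≥ 2`. -/
theorem phiD_two_pred (D : ℕ) (hD : 2 ≤ D) : phiD D (2 * (D - 1)) = 2 * (D - 2) := by
  rw [phiD_mod]
  have h : 2 * (D - 1) = D + (D - 2) := by omega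
  rw [h, Nat.add_mod_left, Nat.mod_eq_of_lt (by omega : D - 2 < D), phiD_of_lt D _ (by omega)]
  have : D - (D - 2) = 2 := by omega
  rw [this]
  ring

/-- The residue minimum at `r = D − 1` is the bipartite value `2 (D − 1)`. -/
theorem residue_min_pred (D : ℕ) (hD : 2 ≤ D) :
    min (2 * ((D - 1) * (D - (D - 1)))) (2 * min (D - 1) (D - (D - 1)) + phiD D (2 * (D - 1))) = 2 * (D - 1) := by
  rw [phiD_two_pred D hD]
  have e1 : D - (D - 1) = 1 := by omega
  rw [e1, mul_one, min_eq_right (by omega : 1 ≤ D - 1)]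
  apply min_eq_left
  omega

/-- **THE EXACT BOTTOM AT `r = 1`, ALL GRAPHS, EVERY `ℓ`:** for `2 ≤ D ≤ m`, `t = m D + 1`, `m + 1 ≤ ℓ`, `2 t ≤ s`,
every graph on `ℓ + 1 + (s − t)` vertices with a vertex of degree `s − t` and every off-degree `≤ D` has
`t (t − 1) + 2 (D − 1) ≤ 2 j + 2 t (D − 1)`, and the near-regular witness attains it. -/
theorem else_bottom_exact_residue_one (s ℓ m D : ℕ) (hD : 2 ≤ D) (hDm : D ≤ m) (hmℓ : m + 1 ≤ ℓ)
    (hs : 2 * (m * D + 1) ≤ s) :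
    (∀ (H : SimpleGraph (Fin (ℓ + 1 + (s - (m * D + 1))))) [DecidableRel H.Adj], H.CliqueFree 3 →
      H.edgeFinset.card = s → ∀ w, deg H w + (m * D + 1) = s → (∀ v, offDeg H w v ≤ D) →
      ∀ j, ∑ v, deg H v * deg H v + 2 * ((m * D + 1) * (s - (m * D + 1) - 1)) + 2 * j = s * (s + 1) →
      (m * D + 1) * (m * D + 1 - 1) + 2 * (D - 1) ≤ 2 * j + 2 * ((m * D + 1) * (D - 1))) ∧
    (∃ (H : SimpleGraph (Fin (ℓ + 1 + (s - (m * D + 1))))) (_ : DecidableRel H.Adj), H.CliqueFree 3 ∧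
      H.edgeFinset.card = s ∧ ∃ w, deg H w + (m * D + 1) = s ∧ (∀ v, offDeg H w v ≤ D) ∧
        (∃ x, ¬ H.Adj w x ∧ offDeg H w x = D) ∧
        ∃ j, ∑ v, deg H v * deg H v + 2 * ((m * D + 1) * (s - (m * D + 1) - 1)) + 2 * j = s * (s + 1) ∧
          2 * j + 2 * ((m * D + 1) * (D - 1)) = (m * D + 1) * (m * D + 1 - 1) + 2 * (D - 1)) := by
  have hmod : (m * D + 1) % D = 1 := by
    rw [Nat.add_comm, Nat.add_mul_mod_self_right, Nat.mod_eq_of_lt (by omega)]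
  constructor
  · intro H _ hfree hsH w hw hD' j hj
    have hw1 : 1 ≤ deg H w := by
      have : 0 < m * D := Nat.mul_pos (by omega) (by omega)
      omega
    have h := band_ge_residue_min H hfree s (m * D + 1) j D hsH w hw hw1 hj hD' (by omega)
    rw [hmod, residue_min_one D hD] at h
    exact h
  · obtain ⟨H, inst, hfree, -, hcard, w, hw, hD', hx, j, hj, hval⟩ := nearRegularWitness s ℓ m 1 D hD hDm (by omega) hmℓ hs
    refine ⟨H, inst, hfree, hcard, w, hw, hD', hx, j, hj, ?_⟩
    rw [hval, phiD_mod, hmod, phiD_of_lt D 1 (by omega)]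
    ring

/-- **THE EXACT BOTTOM AT `r = D − 1`, ALL GRAPHS, EVERY `ℓ`:** for `2 ≤ D ≤ m`, `t = m D + (D − 1)`, `m + 1 ≤ ℓ`,
`2 t ≤ s`, every graph on `ℓ + 1 + (s − t)` vertices with a vertex of degree `s − t` and every off-degree `≤ D` has
`t (t − 1) + 2 (D − 1) ≤ 2 j + 2 t (D − 1)`, and the near-regular witness attains it. -/
theorem else_bottom_exact_residue_pred (s ℓ m D : ℕ) (hD : 2 ≤ D) (hDm : D ≤ m) (hmℓ : m + 1 ≤ ℓ)
    (hs : 2 * (m * D + (D - 1)) ≤ s) :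
    (∀ (H : SimpleGraph (Fin (ℓ + 1 + (s - (m * D + (D - 1)))))) [DecidableRel H.Adj], H.CliqueFree 3 →
      H.edgeFinset.card = s → ∀ w, deg H w + (m * D + (D - 1)) = s → (∀ v, offDeg H w v ≤ D) →
      ∀ j, ∑ v, deg H v * deg H v + 2 * ((m * D + (D - 1)) * (s - (m * D + (D - 1)) - 1)) + 2 * j = s * (s + 1) →
      (m * D + (D - 1)) * (m * D + (D - 1) - 1) + 2 * (D - 1) ≤ 2 * j + 2 * ((m * D + (D - 1)) * (D - 1))) ∧
    (∃ (H : SimpleGraph (Fin (ℓ + 1 + (s - (m * D + (D - 1)))))) (_ : DecidableRel H.Adj), H.CliqueFree 3 ∧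
      H.edgeFinset.card = s ∧ ∃ w, deg H w + (m * D + (D - 1)) = s ∧ (∀ v, offDeg H w v ≤ D) ∧
        (∃ x, ¬ H.Adj w x ∧ offDeg H w x = D) ∧
        ∃ j, ∑ v, deg H v * deg H v + 2 * ((m * D + (D - 1)) * (s - (m * D + (D - 1)) - 1)) + 2 * j = s * (s + 1) ∧
          2 * j + 2 * ((m * D + (D - 1)) * (D - 1)) = (m * D + (D - 1)) * (m * D + (D - 1) - 1) + 2 * (D - 1)) := by
  have hmod : (m * D + (D - 1)) % D = D - 1 := by
    rw [Nat.add_comm, Nat.add_mul_mod_self_right, Nat.mod_eq_of_lt (by omega)]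
  constructor
  · intro H _ hfree hsH w hw hD' j hj
    have hw1 : 1 ≤ deg H w := by
      have : 0 < m * D := Nat.mul_pos (by omega) (by omega)
      omega
    have h := band_ge_residue_min H hfree s (m * D + (D - 1)) j D hsH w hw hw1 hj hD' (by omega)
    rw [hmod, residue_min_pred D hD] at h
    exact h
  · obtain ⟨H, inst, hfree, -, hcard, w, hw, hD', hx, j, hj, hval⟩ :=
      nearRegularWitness s ℓ m (D - 1) D hD hDm (by omega) hmℓ hs
    refine ⟨H, inst, hfree, hcard, w, hw, hD', hx, j, hj, ?_⟩
    rw [hval, phiD_mod, hmod, phiD_of_lt D (D - 1) (by omega)]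
    have : D - (D - 1) = 1 := by omega
    rw [this]
    ring

end C047

end TriangleCap

end PercRepro
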